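import Mathlib
import Summits.Parity.GeneralizedHardyLittlewood.Theorems.LiouvilleShiftedTablesPairsFromMAvgMoebiusSums
import Summits.Parity.GeneralizedHardyLittlewood.Theorems.LiouvilleShiftedTablesPairsFromMAvgEulerWeight
import Summits.Parity.GeneralizedHardyLittlewood.Theorems.LiouvilleShiftedTablesPairsFromMAvgSingularSeries

/-!
# `PairsFromMAvg`, part 4: the three truncated singular-series sums

Route `LiouvilleShiftedTables` (Parity / GeneralizedHardyLittlewood), support item stmt-Parity-14275
(`PairsFromMAvg`). Specialising the abstract estimates of part 1 to the weights `G_h = b_h ⋆ μ` of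
part 2 and the Euler product of part 3 gives, for fixed `h ≠ 0`:

* `exists_abs_sum_coprime_moebius_div_totient_le` — `∑_{d ≤ D, (d,h)=1} μ(d)/φ(d) ≪_h (log D)⁻²`;
* `exists_abs_sum_coprime_moebius_mul_self_div_totient_le` — `∑_{d ≤ D, (d,h)=1} μ(d) d/φ(d) ≪_h D (log D)⁻²`;
* `tendsto_sum_coprime_moebius_mul_log_div_totient` —
  `∑_{d ≤ D, (d,h)=1} μ(d) log d/φ(d) → -𝔖({0,h})` (`D → ∞`).

(Goldston–Yıldırım, Lemma 2.1 at `j = 1`, for FIXED `h`, with `(log D)⁻²` in place of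
`exp(-c√log D)`; all from the prime number theorem for `μ` PROVED in the tree.)
[folklore; cite: GoldstonYildirim2001, Lemma 2.1]
-/

noncomputable section

open Finset Real ArithmeticFunction Filter
open scoped ArithmeticFunction.Moebius Topology

namespace Summit.Parity.GeneralizedHardyLittlewood.Theorems.PairsFromMAvg

open Literature.NumberTheory.Sieve (singularSeries)

/-- `x^{-a} ≤ (2/a)²/(log x)²` for `x > 1`, `a > 0` (`log x ≤ x^{a/2}/(a/2)`). [folklore] -/
theorem rpow_neg_le_div_log_sq {x a : ℝ} (hx : 1 < x) (ha : 0 < a) :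
    x ^ (-a) ≤ (2 / a) ^ 2 / Real.log x ^ 2 := by
  have hx0 : 0 < x := by linarith
  have hlog : 0 < Real.log x := Real.log_pos hx
  have h1 : Real.log x ≤ x ^ (a / 2) / (a / 2) := Real.log_le_rpow_div hx0.le (by positivity)
  have h2 : Real.log x ^ 2 ≤ (2 / a) ^ 2 * x ^ a := by
    calc Real.log x ^ 2 ≤ (x ^ (a / 2) / (a / 2)) ^ 2 := by gcongr
      _ = (2 / a) ^ 2 * (x ^ (a / 2)) ^ 2 := by ring
      _ = (2 / a) ^ 2 * x ^ a := by
          congr 1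
          rw [← Real.rpow_natCast, ← Real.rpow_mul hx0.le]; norm_num
  rw [Real.rpow_neg hx0.le, inv_le_iff_one_le_mul₀ (Real.rpow_pos_of_pos hx0 a),
    div_mul_eq_mul_div, one_le_div (by positivity)]
  linarith

/-- Summability of `b(n)/n` from the uniform bound `∑_{n ≤ N} |b(n)|/√n ≤ S`. [folklore] -/
theorem summable_norm_div_of_bound (b : ArithmeticFunction ℝ) {S : ℝ}
    (hS : ∀ N, ∑ n ∈ Icc 1 N, |b n| / Real.sqrt n ≤ S) :
    Summable fun n : ℕ => ‖b n / n‖ := by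
  have hg0 : ∀ n : ℕ, 0 ≤ |b n| / Real.sqrt n := fun n => by positivity
  have hg : Summable fun n : ℕ => |b n| / Real.sqrt n := by
    refine summable_of_sum_range_le hg0 (c := S) fun n => ?_
    have h0 : |b 0| / Real.sqrt ((0 : ℕ) : ℝ) = 0 := by simp
    calc ∑ i ∈ Finset.range n, |b i| / Real.sqrt i ≤ ∑ i ∈ Finset.range (n + 1), |b i| / Real.sqrt i := by
          rw [Finset.sum_range_succ]; linarith [hg0 n]
      _ = ∑ i ∈ Icc 1 n, |b i| / Real.sqrt i := by
          refine (Finset.sum_subset (fun i hi => ?_) (fun i hi hi' => ?_)).symm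
          · rw [Finset.mem_range]; exact Nat.lt_succ_of_le (Finset.mem_Icc.mp hi).2
          · have : i = 0 := by
              rw [Finset.mem_range] at hi; rw [Finset.mem_Icc] at hi'; omega
            rw [this, h0]
      _ ≤ S := hS n
  refine Summable.of_nonneg_of_le (fun n => norm_nonneg _) (fun n => ?_) hg
  rw [norm_div, Real.norm_eq_abs, Real.norm_eq_abs, Nat.abs_cast]
  rcases Nat.eq_zero_or_pos n with rfl | hn
  · simp
  · have hn0 : (0 : ℝ) < n := by exact_mod_cast hn
    refine div_le_div_of_nonneg_left (abs_nonneg _) (Real.sqrt_pos.mpr hn0) ?_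
    calc Real.sqrt n = Real.sqrt n * 1 := (mul_one _).symm
      _ ≤ Real.sqrt n * Real.sqrt n := by
          gcongr
          rw [← Real.sqrt_one]; exact Real.sqrt_le_sqrt (by exact_mod_cast hn)
      _ = n := Real.mul_self_sqrt hn0.le

/-- `∑_{n < D+1} b(n)/n = ∑_{1 ≤ n ≤ D} b(n)/n` (the `n = 0` term vanishes). [folklore] -/
theorem sum_range_succ_eq_sum_Icc (b : ArithmeticFunction ℝ) (D : ℕ) :
    ∑ n ∈ Finset.range (D + 1), b n / n = ∑ n ∈ Icc 1 D, b n / n := by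
  refine (Finset.sum_subset (fun i hi => ?_) (fun i hi hi' => ?_)).symm
  · rw [Finset.mem_range]; exact Nat.lt_succ_of_le (Finset.mem_Icc.mp hi).2
  · have : i = 0 := by
      rw [Finset.mem_range] at hi; rw [Finset.mem_Icc] at hi'; omega
    rw [this]; simp

/-- Rewriting `∑_{d ≤ D} G(d) w(d)` with `G(d) = μ(d) d/φ(d) 1_{(d,h)=1}` as a sum over `(d,h) = 1`.
[folklore] -/
theorem sum_weight_mul_eq_sum_filter {h : ℕ} (G : ArithmeticFunction ℝ)
    (hG : ∀ d : ℕ, G d = (μ d : ℝ) * ((d : ℝ) / Nat.totient d) * (if d.Coprime h then 1 else 0))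
    (w : ℕ → ℝ) (D : ℕ) :
    ∑ d ∈ Icc 1 D, G d * w d =
      ∑ d ∈ (Icc 1 D).filter (fun d => d.Coprime h), (μ d : ℝ) * ((d : ℝ) / Nat.totient d) * w d := by
  rw [Finset.sum_filter]
  refine Finset.sum_congr rfl fun d _ => ?_
  rw [hG]
  split_ifs <;> simp

/-- **`∑_{d ≤ D, (d,h)=1} μ(d)/φ(d) ≪_h (log D)⁻²`** (`D ≥ 64`). [folklore] -/
theorem exists_abs_sum_coprime_moebius_div_totient_le {h : ℕ} (hh : h ≠ 0) :
    ∃ C : ℝ, ∀ D : ℕ, 64 ≤ D →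
      |∑ d ∈ (Icc 1 D).filter (fun d => d.Coprime h), (μ d : ℝ) / Nat.totient d| ≤
        C / Real.log D ^ 2 := by
  obtain ⟨G, b, -, hb, hG, hbG, hbp⟩ := exists_weights h
  obtain ⟨S, hS⟩ := exists_sum_abs_div_sqrt_le hh b hb hbp
  obtain ⟨K, hK0, hK⟩ := exists_abs_sum_moebius_div_le
  obtain ⟨Cm, hCm0, hCm⟩ := exists_abs_sum_moebius_div_le_div_log_sq
  have hS0 : 0 ≤ S := le_trans (by simp) (hS 0)
  refine ⟨S * (9 * Cm) + S * K * 8 ^ 2, fun D hD => ?_⟩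
  have hD1 : (1 : ℝ) < D := by exact_mod_cast (by omega : 1 < D)
  have hlog : 0 < Real.log D := Real.log_pos hD1
  have h1 := abs_sum_convMoebius_div_le b hS hK hCm0 hCm hD
  rw [hbG] at h1
  have hre : ∑ d ∈ Icc 1 D, G d / d =
      ∑ d ∈ (Icc 1 D).filter (fun d => d.Coprime h), (μ d : ℝ) / Nat.totient d := by
    simp only [div_eq_mul_one_div (G _)]
    rw [sum_weight_mul_eq_sum_filter G hG]
    refine Finset.sum_congr rfl fun d hd => ?_
    have hd0 : (d : ℝ) ≠ 0 := by
      exact_mod_cast (Nat.pos_of_ne_zero (by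
        have := (Finset.mem_Icc.mp (Finset.mem_filter.mp hd).1).1; omega)).ne'
    field_simp
  rw [hre] at h1
  have hr := rpow_neg_le_div_log_sq hD1 (by norm_num : (0 : ℝ) < 1 / 4)
  calc _ ≤ S * (9 * Cm / Real.log D ^ 2) + S * (K * (D : ℝ) ^ (-(1 / 4 : ℝ))) := h1
    _ ≤ S * (9 * Cm / Real.log D ^ 2) + S * (K * ((2 / (1 / 4)) ^ 2 / Real.log D ^ 2)) := by
        gcongr
    _ = (S * (9 * Cm) + S * K * 8 ^ 2) / Real.log D ^ 2 := by
        field_simp; ring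

/-- **`∑_{d ≤ D, (d,h)=1} μ(d) d/φ(d) ≪_h D (log D)⁻²`** (`D ≥ 64`). [folklore] -/
theorem exists_abs_sum_coprime_moebius_mul_self_div_totient_le {h : ℕ} (hh : h ≠ 0) :
    ∃ C : ℝ, ∀ D : ℕ, 64 ≤ D →
      |∑ d ∈ (Icc 1 D).filter (fun d => d.Coprime h), (μ d : ℝ) * d / Nat.totient d| ≤
        C * D / Real.log D ^ 2 := by
  obtain ⟨G, b, -, hb, hG, hbG, hbp⟩ := exists_weights h
  obtain ⟨S, hS⟩ := exists_sum_abs_div_sqrt_le hh b hb hbp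
  obtain ⟨CM, hCM0, hCM⟩ := exists_abs_sum_moebius_le_div_log_sq
  have hS0 : 0 ≤ S := le_trans (by simp) (hS 0)
  refine ⟨S * (9 * CM) + S * 8 ^ 2, fun D hD => ?_⟩
  have hD1 : (1 : ℝ) < D := by exact_mod_cast (by omega : 1 < D)
  have hD0 : (0 : ℝ) < D := by linarith
  have hlog : 0 < Real.log D := Real.log_pos hD1
  have h1 := abs_sum_convMoebius_le b hS hCM0 hCM hD
  rw [hbG] at h1
  have hre : ∑ d ∈ Icc 1 D, G d =
      ∑ d ∈ (Icc 1 D).filter (fun d => d.Coprime h), (μ d : ℝ) * d / Nat.totient d := by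
    have := sum_weight_mul_eq_sum_filter G hG (fun _ => (1 : ℝ)) D
    simp only [mul_one] at this
    rw [this]
    refine Finset.sum_congr rfl fun d _ => ?_
    ring
  rw [hre] at h1
  have hr := rpow_neg_le_div_log_sq hD1 (by norm_num : (0 : ℝ) < 1 / 4)
  calc _ ≤ S * (9 * CM * D / Real.log D ^ 2) + S * ((D : ℝ) * (D : ℝ) ^ (-(1 / 4 : ℝ))) := h1
    _ ≤ S * (9 * CM * D / Real.log D ^ 2) + S * ((D : ℝ) * ((2 / (1 / 4)) ^ 2 / Real.log D ^ 2)) := by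
        gcongr
    _ = (S * (9 * CM) + S * 8 ^ 2) * D / Real.log D ^ 2 := by
        field_simp; ring

/-- **`∑_{d ≤ D, (d,h)=1} μ(d) log d/φ(d) → -𝔖({0,h})`** as `D → ∞` (Goldston–Yıldırım (2.11) at
`j = 1` for fixed `h`, qualitative form). [cite: GoldstonYildirim2001, Lemma 2.1] -/
theorem tendsto_sum_coprime_moebius_mul_log_div_totient {h : ℕ} (hh : h ≠ 0) :
    Tendsto (fun D : ℕ => ∑ d ∈ (Icc 1 D).filter (fun d => d.Coprime h),
        (μ d : ℝ) * Real.log d / Nat.totient d) atTop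
      (𝓝 (-singularSeries ({0, (h : ℤ)} : Finset ℤ))) := by
  obtain ⟨G, b, -, hb, hG, hbG, hbp⟩ := exists_weights h
  obtain ⟨S, hS⟩ := exists_sum_abs_div_sqrt_le hh b hb hbp
  obtain ⟨K, hK0, hK⟩ := exists_abs_sum_moebius_div_le
  obtain ⟨K₁, hK₁0, hK₁⟩ := exists_abs_sum_moebius_log_div_add_one_le
  obtain ⟨Cm, hCm0, hCm⟩ := exists_abs_sum_moebius_div_le_div_log_sq
  obtain ⟨C₁, hC₁0, hC₁⟩ := exists_abs_sum_moebius_log_div_add_one_le_div_log_sq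
  have hS0 : 0 ≤ S := le_trans (by simp) (hS 0)
  have hsum := summable_norm_div_of_bound b hS
  have h𝔖 := tsum_weight_div_eq_singularSeries hh b hb hbp hsum
  set a : ℕ → ℝ := fun D => ∑ d ∈ (Icc 1 D).filter (fun d => d.Coprime h),
    (μ d : ℝ) * Real.log d / Nat.totient d with ha
  set s : ℕ → ℝ := fun D => ∑ n ∈ Icc 1 D, b n / n with hs
  -- `s D → 𝔖`
  have hs_lim : Tendsto s atTop (𝓝 (singularSeries ({0, (h : ℤ)} : Finset ℤ))) := by
    rw [← h𝔖]
    have := (hsum.of_norm.tendsto_sum_tsum_nat).comp (tendsto_add_atTop_nat 1)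
    refine this.congr fun D => ?_
    simp only [Function.comp_apply, hs]
    exact sum_range_succ_eq_sum_Icc b D
  -- `a D + s D → 0`
  have hre : ∀ D : ℕ, ∑ d ∈ Icc 1 D, (b * (μ : ArithmeticFunction ℝ)) d * Real.log d / d = a D := by
    intro D
    rw [ha, hbG]
    simp only [mul_div_assoc]
    rw [sum_weight_mul_eq_sum_filter G hG]
    refine Finset.sum_congr rfl fun d hd => ?_
    have hd0 : (d : ℝ) ≠ 0 := by
      exact_mod_cast (Nat.pos_of_ne_zero (by
        have := (Finset.mem_Icc.mp (Finset.mem_filter.mp hd).1).1; omega)).ne'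
    field_simp
  have hbound : ∀ D : ℕ, 64 ≤ D → |a D + s D| ≤
      S * (27 * (Cm + C₁) / Real.log D ^ 2) + S * (5 * (K + K₁) * (D : ℝ) ^ (-(1 / 8 : ℝ))) := by
    intro D hD
    have := abs_sum_convMoebius_log_div_add_le b hS hK hK₁ hCm0 hCm hC₁0 hC₁ hD
    rwa [hre D] at this
  have hε : Tendsto (fun D : ℕ => S * (27 * (Cm + C₁) / Real.log D ^ 2) +
      S * (5 * (K + K₁) * (D : ℝ) ^ (-(1 / 8 : ℝ)))) atTop (𝓝 0) := by
    have hlog : Tendsto (fun D : ℕ => Real.log D ^ 2) atTop atTop :=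
      (tendsto_pow_atTop two_ne_zero).comp (Real.tendsto_log_atTop.comp tendsto_natCast_atTop_atTop)
    have h1 : Tendsto (fun D : ℕ => S * (27 * (Cm + C₁) / Real.log D ^ 2)) atTop (𝓝 0) := by
      have := (hlog.inv_tendsto_atTop).const_mul (S * (27 * (Cm + C₁)))
      rw [mul_zero] at this
      refine this.congr fun D => ?_
      simp only [Pi.inv_apply]
      ring
    have h2 : Tendsto (fun D : ℕ => S * (5 * (K + K₁) * (D : ℝ) ^ (-(1 / 8 : ℝ)))) atTop (𝓝 0) := by
      have := ((tendsto_rpow_neg_atTop (by norm_num : (0 : ℝ) < 1 / 8)).comp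
        tendsto_natCast_atTop_atTop).const_mul (S * (5 * (K + K₁)))
      rw [mul_zero] at this
      refine this.congr fun D => ?_
      simp only [Function.comp_apply]
      ring
    have := h1.add h2
    rwa [add_zero] at this
  have has : Tendsto (fun D => a D + s D) atTop (𝓝 0) := by
    refine squeeze_zero_norm' ?_ hε
    filter_upwards [eventually_ge_atTop 64] with D hD
    rw [Real.norm_eq_abs]
    exact hbound D hD
  have := has.sub hs_lim
  rw [zero_sub] at this
  refine this.congr fun D => ?_
  ring

end Summit.Parity.GeneralizedHardyLittlewood.Theorems.PairsFromMAvg
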